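import Literature.NumberTheory.Sieve.PolymathGEHTypeII
import Literature.NumberTheory.Sieve.PolymathGEHPieces
import Literature.NumberTheory.Sieve.CircleMethod
import Literature.NumberTheory.Sieve.HeathBrownIdentity
import HarnessLib

/-!
# Proposition 2.7 (`GEH ⟹ EH`): Vaughan's identity cut into `ρ`-adic pieces

Trunk AntSieve, tooling toward the named fact `Literature.NumberTheory.Sieve.weakDHL_three_two_of_GEH`
(D. H. J. Polymath, Res. Math. Sci. 1:12 (2014) = arXiv:1407.4897, Theorem 3.2(xii)).  The printed
proof of Proposition 2.7 is one sentence ("Vaughan's identity and dyadic decomposition", p. 7); this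
file supplies the decomposition.  With the tree's four-term Vaughan identity
(`vaughan_identity_add_holds U V`: `Λ = Λ_{≤V} + μ_{≤U} ⋆ log − μ_{≤U} ⋆ Λ_{≤V} ⋆ 1 + (μ − μ_{≤U}) ⋆ (Λ − Λ_{≤V}) ⋆ 1`)
the Type II term is `a ⋆ b` with `a = (μ − μ_{≤U}) ⋆ 1` (`aFun U`, `a(m) = Σ_{d ∣ m, d > U} μ(d)`,
`|a| ≤ τ`, `a = 0` on `[1, U]`) and `b = Λ − Λ_{≤V} = Λ 1_{(V, ∞)}`.  Both factors are cut along the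
grid `lo ρ s = ⌊ρ^s⌋` into the pieces `alphaPiece U ρ s = a 1_{(⌊ρ^s⌋, ⌊ρ^{s+1}⌋]}` and
`betaPiece V ρ t = Λ 1_{(max(V, ⌊ρ^t⌋), ⌊ρ^{t+1}⌋]}` (a `vonMangoldtPiece`), and on `[1, N]`,
`N ≤ ⌊ρ^{S+1}⌋`, one has `a ⋆ b = Σ_{s, t ≤ S} alphaPiece s ⋆ betaPiece t` (`typeII_eq_sum_pieces`),
whence the progression discrepancy of `Λ` on `[1, N]` splits accordingly
(`apDiscrepancy_vonMangoldt_eq`).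

## References

* [Polymath8b2014] D. H. J. Polymath, Res. Math. Sci. 1 (2014), Art. 12 = arXiv:1407.4897,
  Proposition 2.7 (p. 7).
* [IwaniecKowalski2004] H. Iwaniec, E. Kowalski, *Analytic Number Theory*, Prop. 13.4.
-/

noncomputable section

open Finset Real
open scoped ArithmeticFunction.Moebius ArithmeticFunction.vonMangoldt ArithmeticFunction.zeta
  ArithmeticFunction.sigma

namespace Literature.NumberTheory.Sieve

namespace GEHtoEH

/-! ### The grid and the pieces -/

/-- The grid point `⌊ρ^s⌋`. [cite: Polymath8b2014, Proposition 2.7] -/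
def lo (ρ : ℝ) (s : ℕ) : ℕ := ⌊ρ ^ s⌋₊

/-- `lo ρ 0 = 1`. [folklore] -/
theorem lo_zero (ρ : ℝ) : lo ρ 0 = 1 := by simp [lo]

/-- The grid is monotone for `ρ ≥ 1`. [folklore] -/
theorem lo_mono {ρ : ℝ} (hρ : 1 ≤ ρ) : Monotone (lo ρ) := by
  intro s t hst
  exact Nat.floor_le_floor (pow_le_pow_right₀ hρ hst)

/-- The Type II coefficient `a = (μ − μ_{≤U}) ⋆ 1`, `a(m) = Σ_{d ∣ m, d > U} μ(d)`.
[cite: Polymath8b2014, Proposition 2.7] -/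
def aFun (U : ℕ) : ArithmeticFunction ℝ :=
  ((μ : ArithmeticFunction ℝ) - (moebiusTrunc U : ArithmeticFunction ℝ)) * (ζ : ArithmeticFunction ℝ)

/-- Values of a difference of real arithmetic functions. [folklore] -/
theorem af_sub_apply (f g : ArithmeticFunction ℝ) (n : ℕ) : (f - g) n = f n - g n := by
  rw [sub_eq_add_neg, ArithmeticFunction.add_apply, ArithmeticFunction.neg_apply, ← sub_eq_add_neg]

/-- `a(m) = Σ_{d ∣ m, U < d} μ(d)`. [folklore] -/
theorem aFun_apply (U m : ℕ) : aFun U m = ∑ d ∈ m.divisors.filter (fun d => U < d), (μ d : ℝ) := by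
  unfold aFun
  rw [ArithmeticFunction.coe_mul_zeta_apply, Finset.sum_filter]
  refine Finset.sum_congr rfl fun d _ => ?_
  simp only [af_sub_apply, ArithmeticFunction.intCoe_apply, moebiusTrunc_apply]
  split_ifs with h1 h2 h2
  · omega
  · simp
  · simp
  · omega

/-- `|a(m)| ≤ τ(m)`. [folklore] -/
theorem abs_aFun_le (U m : ℕ) : |aFun U m| ≤ (σ 0 m : ℝ) := by
  rw [aFun_apply, ArithmeticFunction.sigma_zero_apply]
  refine (Finset.abs_sum_le_sum_abs _ _).trans ?_
  calc ∑ d ∈ m.divisors.filter (fun d => U < d), |(μ d : ℝ)| ≤ ∑ d ∈ m.divisors.filter (fun d => U < d), (1 : ℝ) :=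
        Finset.sum_le_sum fun d _ => by exact_mod_cast ArithmeticFunction.abs_moebius_le_one
    _ = #(m.divisors.filter (fun d => U < d)) := by simp
    _ ≤ #m.divisors := by exact_mod_cast Finset.card_filter_le _ _

/-- `a(m) = 0` for `m ≤ U`. [folklore] -/
theorem aFun_eq_zero {U m : ℕ} (hm : m ≤ U) : aFun U m = 0 := by
  rw [aFun_apply]
  refine Finset.sum_eq_zero fun d hd => ?_
  rw [Finset.mem_filter, Nat.mem_divisors] at hd
  have := Nat.le_of_dvd (Nat.pos_of_ne_zero hd.1.2) hd.1.1
  omega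

/-- The Type II factor `b = Λ − Λ_{≤V} = Λ 1_{(V, ∞)}`. [cite: Polymath8b2014, Proposition 2.7] -/
def bFun (V : ℕ) : ArithmeticFunction ℝ := (Λ : ArithmeticFunction ℝ) - vonMangoldtTrunc V

/-- `b(c) = Λ(c)` for `c > V`, `0` otherwise. [folklore] -/
theorem bFun_apply (V c : ℕ) : bFun V c = if V < c then Λ c else 0 := by
  unfold bFun
  simp only [af_sub_apply, vonMangoldtTrunc_apply]
  split_ifs with h1 h2 h2
  · omega
  · ring
  · ring
  · omega

/-- The `α`-pieces `a 1_{(⌊ρ^s⌋, ⌊ρ^{s+1}⌋]}`. [cite: Polymath8b2014, Proposition 2.7] -/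
def alphaPiece (U : ℕ) (ρ : ℝ) (s : ℕ) : ArithmeticFunction ℝ :=
  ⟨fun n => if lo ρ s < n ∧ n ≤ lo ρ (s + 1) then aFun U n else 0, by simp⟩

/-- Values of the `α`-pieces. [folklore] -/
theorem alphaPiece_apply (U : ℕ) (ρ : ℝ) (s n : ℕ) :
    alphaPiece U ρ s n = if lo ρ s < n ∧ n ≤ lo ρ (s + 1) then aFun U n else 0 := rfl

/-- The `β`-pieces `Λ 1_{(max(V, ⌊ρ^t⌋), ⌊ρ^{t+1}⌋]}`, a `vonMangoldtPiece`. [cite: Polymath8b2014, Proposition 2.7] -/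
def betaPiece (V : ℕ) (ρ : ℝ) (t : ℕ) : ArithmeticFunction ℝ := vonMangoldtPiece (max V (lo ρ t)) (lo ρ (t + 1))

/-- Values of the `β`-pieces. [folklore] -/
theorem betaPiece_apply (V : ℕ) (ρ : ℝ) (t c : ℕ) :
    betaPiece V ρ t c = if max V (lo ρ t) < c ∧ c ≤ lo ρ (t + 1) then Λ c else 0 := by
  rw [betaPiece, vonMangoldtPiece_apply]

/-- The `β`-pieces are nonnegative. [folklore] -/
theorem betaPiece_nonneg (V : ℕ) (ρ : ℝ) (t c : ℕ) : 0 ≤ betaPiece V ρ t c := by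
  rw [betaPiece]; exact vonMangoldtPiece_nonneg _ _ _

/-! ### The pieces add up on `[1, ⌊ρ^{S+1}⌋]` -/

/-- **Partition along the grid**: for `ρ ≥ 1` and any `f`,
`Σ_{t ≤ S} [⌊ρ^t⌋ < c ≤ ⌊ρ^{t+1}⌋] f(c) = [1 < c ≤ ⌊ρ^{S+1}⌋] f(c)`. [folklore] -/
theorem sum_range_ite_lo {ρ : ℝ} (hρ : 1 ≤ ρ) (f : ℕ → ℝ) (c : ℕ) (S : ℕ) :
    ∑ t ∈ range (S + 1), (if lo ρ t < c ∧ c ≤ lo ρ (t + 1) then f c else 0) =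
      if 1 < c ∧ c ≤ lo ρ (S + 1) then f c else 0 := by
  induction S with
  | zero => simp [lo_zero]
  | succ S ih =>
    rw [Finset.sum_range_succ, ih]
    have hmono := lo_mono hρ (Nat.le_succ (S + 1))
    have h1 : 1 ≤ lo ρ (S + 1) := by
      have := lo_mono hρ (Nat.zero_le (S + 1)); rwa [lo_zero] at this
    by_cases hc : 1 < c ∧ c ≤ lo ρ (S + 1)
    · rw [if_pos hc, if_neg (by omega), if_pos ⟨hc.1, hc.2.trans hmono⟩, add_zero]
    · rw [if_neg hc, zero_add]
      by_cases hc' : lo ρ (S + 1) < c ∧ c ≤ lo ρ (S + 1 + 1)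
      · rw [if_pos hc', if_pos ⟨by omega, hc'.2⟩]
      · rw [if_neg hc', if_neg (by omega)]

/-- `a = Σ_{s ≤ S} alphaPiece s` on `[1, ⌊ρ^{S+1}⌋]` (`U ≥ 1`, `ρ ≥ 1`). [folklore] -/
theorem aFun_eq_sum_alphaPiece {U : ℕ} (hU : 1 ≤ U) {ρ : ℝ} (hρ : 1 ≤ ρ) (S : ℕ) {n : ℕ}
    (hn : n ≤ lo ρ (S + 1)) : aFun U n = ∑ s ∈ range (S + 1), alphaPiece U ρ s n := by
  simp only [alphaPiece_apply]
  rw [sum_range_ite_lo hρ]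
  by_cases h : 1 < n
  · rw [if_pos ⟨h, hn⟩]
  · rw [if_neg (fun h' => h h'.1), aFun_eq_zero (by omega)]

/-- `b = Σ_{t ≤ S} betaPiece t` on `[1, ⌊ρ^{S+1}⌋]` (`ρ ≥ 1`). [folklore] -/
theorem bFun_eq_sum_betaPiece (V : ℕ) {ρ : ℝ} (hρ : 1 ≤ ρ) (S : ℕ) {c : ℕ} (hc : c ≤ lo ρ (S + 1)) :
    bFun V c = ∑ t ∈ range (S + 1), betaPiece V ρ t c := by
  have e : ∀ t, betaPiece V ρ t c = if lo ρ t < c ∧ c ≤ lo ρ (t + 1) then bFun V c else 0 := by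
    intro t
    rw [betaPiece_apply, bFun_apply]
    by_cases h1 : lo ρ t < c ∧ c ≤ lo ρ (t + 1)
    · rw [if_pos h1]
      by_cases h2 : V < c
      · rw [if_pos h2, if_pos ⟨max_lt h2 h1.1, h1.2⟩]
      · rw [if_neg h2, if_neg (fun h => h2 (lt_of_le_of_lt (le_max_left _ _) h.1))]
    · rw [if_neg h1, if_neg (fun h => h1 ⟨lt_of_le_of_lt (le_max_right _ _) h.1, h.2⟩)]
  simp only [e]
  rw [sum_range_ite_lo hρ]
  by_cases h : 1 < c
  · rw [if_pos ⟨h, hc⟩]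
  · rw [if_neg (fun h' => h h'.1), bFun_apply]
    split_ifs
    · interval_cases c <;> simp
    · rfl

/-- **Locality of the Dirichlet convolution**: if `f = f'` and `g = g'` on `[1, N]` then
`(f ⋆ g)(n) = (f' ⋆ g')(n)` for `n ≤ N`. [folklore] -/
theorem mul_apply_congr_of_le {f f' g g' : ArithmeticFunction ℝ} {N : ℕ}
    (hf : ∀ n, 1 ≤ n → n ≤ N → f n = f' n) (hg : ∀ n, 1 ≤ n → n ≤ N → g n = g' n) {n : ℕ} (hn : n ≤ N) :
    (f * g) n = (f' * g') n := by
  rw [ArithmeticFunction.mul_apply, ArithmeticFunction.mul_apply]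
  refine Finset.sum_congr rfl fun p hp => ?_
  rw [Nat.mem_divisorsAntidiagonal] at hp
  obtain ⟨hpn, hn0⟩ := hp
  have h1 : 1 ≤ p.1 := Nat.pos_of_ne_zero (by rintro h; rw [h, zero_mul] at hpn; exact hn0 hpn.symm)
  have h2 : 1 ≤ p.2 := Nat.pos_of_ne_zero (by rintro h; rw [h, mul_zero] at hpn; exact hn0 hpn.symm)
  have h3 : p.1 ≤ N := le_trans (Nat.le_of_dvd (Nat.pos_of_ne_zero hn0) (Dvd.intro _ hpn)) hn
  have h4 : p.2 ≤ N := le_trans (Nat.le_of_dvd (Nat.pos_of_ne_zero hn0) (Dvd.intro_left _ hpn)) hn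
  rw [hf p.1 h1 h3, hg p.2 h2 h4]

/-- **The Type II term in pieces**: on `[1, N]`, `N ≤ ⌊ρ^{S+1}⌋`,
`(a ⋆ b)(n) = Σ_{s ≤ S} Σ_{t ≤ S} (alphaPiece s ⋆ betaPiece t)(n)`. [cite: Polymath8b2014, Proposition 2.7] -/
theorem typeII_eq_sum_pieces {U : ℕ} (hU : 1 ≤ U) (V : ℕ) {ρ : ℝ} (hρ : 1 ≤ ρ) (S : ℕ) {N : ℕ}
    (hN : N ≤ lo ρ (S + 1)) {n : ℕ} (hn : n ≤ N) :
    (aFun U * bFun V) n =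
      ∑ s ∈ range (S + 1), ∑ t ∈ range (S + 1), (alphaPiece U ρ s * betaPiece V ρ t) n := by
  have h := mul_apply_congr_of_le (N := N) (f := aFun U) (f' := ∑ s ∈ range (S + 1), alphaPiece U ρ s)
    (g := bFun V) (g' := ∑ t ∈ range (S + 1), betaPiece V ρ t)
    (fun m _ hm => by rw [HeathBrown.finset_sum_apply]; exact aFun_eq_sum_alphaPiece hU hρ S (hm.trans hN))
    (fun c _ hc => by rw [HeathBrown.finset_sum_apply]; exact bFun_eq_sum_betaPiece V hρ S (hc.trans hN)) hn
  rw [h, Finset.sum_mul_sum, HeathBrown.finset_sum_apply]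
  refine Finset.sum_congr rfl fun s _ => ?_
  rw [HeathBrown.finset_sum_apply]

/-! ### The discrepancy of `Λ` on `[1, N]` in pieces -/

/-- **Vaughan's identity for the progression discrepancy**: for `U ≥ 1`, `ρ ≥ 1` and
`N ≤ ⌊ρ^{S+1}⌋`,
`Δ(Λ; N) = Δ(Λ_{≤V}; N) + Δ(μ_{≤U} ⋆ log; N) − Δ(μ_{≤U} ⋆ Λ_{≤V} ⋆ 1; N) + Σ_{s,t ≤ S} Δ(α_s ⋆ β_t; N)`.
[cite: Polymath8b2014, Proposition 2.7] -/
theorem apDiscrepancy_vonMangoldt_eq {U : ℕ} (hU : 1 ≤ U) (V : ℕ) {ρ : ℝ} (hρ : 1 ≤ ρ) (S : ℕ)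
    {N : ℕ} (hN : N ≤ lo ρ (S + 1)) (q : ℕ) (a : (ZMod q)ˣ) :
    apDiscrepancy (fun n => (Λ n : ℝ)) N q a =
      apDiscrepancy (fun n => vonMangoldtTrunc V n) N q a +
      apDiscrepancy (fun n => ((moebiusTrunc U : ArithmeticFunction ℝ) * ArithmeticFunction.log) n) N q a -
      apDiscrepancy (fun n => ((moebiusTrunc U : ArithmeticFunction ℝ) * vonMangoldtTrunc V *
        (ζ : ArithmeticFunction ℝ)) n) N q a +
      ∑ s ∈ range (S + 1), ∑ t ∈ range (S + 1),
        apDiscrepancy (fun n => (alphaPiece U ρ s * betaPiece V ρ t) n) N q a := by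
  -- Vaughan's identity, pointwise on `[1, N]`, with the Type II term in pieces
  have hV := vaughan_identity_add_holds U V
  have hpt : ∀ n ∈ Icc 1 N, (Λ n : ℝ) =
      (vonMangoldtTrunc V n +
        ((moebiusTrunc U : ArithmeticFunction ℝ) * ArithmeticFunction.log) n -
        ((moebiusTrunc U : ArithmeticFunction ℝ) * vonMangoldtTrunc V * (ζ : ArithmeticFunction ℝ)) n) +
      ∑ s ∈ range (S + 1), ∑ t ∈ range (S + 1), (alphaPiece U ρ s * betaPiece V ρ t) n := by
    intro n hn
    rw [Finset.mem_Icc] at hn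
    have h1 := congrArg (fun f : ArithmeticFunction ℝ => f n) hV
    simp only [ArithmeticFunction.add_apply, af_sub_apply] at h1
    rw [← typeII_eq_sum_pieces hU V hρ S hN hn.2]
    have h2 : (((μ : ArithmeticFunction ℝ) - (moebiusTrunc U : ArithmeticFunction ℝ)) *
        ((Λ : ArithmeticFunction ℝ) - vonMangoldtTrunc V) * (ζ : ArithmeticFunction ℝ)) n =
        (aFun U * bFun V) n := by
      unfold aFun bFun
      congr 1
      ring
    rw [← h2]
    exact h1
  rw [apDiscrepancy_congr hpt, apDiscrepancy_add, apDiscrepancy_sub, apDiscrepancy_add,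
    apDiscrepancy_sum]
  congr 1
  exact Finset.sum_congr rfl fun s _ => apDiscrepancy_sum _ _ _ _ _

end GEHtoEH

end Literature.NumberTheory.Sieve
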